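import Literature.NumberTheory.EllipticCurves.TunnellWaldspurgerCorollaryProofs
import Literature.NumberTheory.EllipticCurves.TunnellThmTwoTrivProofs
import HarnessLib

/-!
# Waldspurger's Corollaire 2 at level `128` (trivial character) and Tunnell's Waldspurger leaf

Topic `NumberTheory/EllipticCurves`; namespace `Literature.NumberTheory.EllipticCurves.Tunnell1983`.
Fact-decomposition file (librarian 2026-08-16) for the named fact
`Literature.NumberTheory.EllipticCurves.Tunnell1983.Tunnell1983_waldspurger_triv`
(`TunnellHalfIntegralForms.lean`: "Waldspurger's theorem as applied on p. 329", trivial character —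
J. B. Tunnell, *A classical Diophantine problem and modular forms of weight 3/2*, Invent. Math. 72
(1983), Theorem (Waldspurger) p. 328 and proof of Thm 3, p. 329, ll. 7–12; J.-L. Waldspurger,
J. Math. Pures Appl. 60 (1981), Thm 1).

State of the tree. The leaf is machine-proved EQUIVALENT to the arithmetic display
`Tunnell1983_a_sq_propto_L_one` (`Tunnell1983_waldspurger_triv_iff_propto`,
`TunnellFormsCuspidalProofs.lean`), and `TunnellWaldspurgerCorollaryProofs.lean` proves both from
Tunnell's **Theorem 2** — now a THEOREM of the tree, `Tunnell1983_thm2_triv_holds`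
(`TunnellThmTwoTrivProofs.lean`) — and the exact published statement behind the leaf,
**Waldspurger 1981, Corollaire 2** (p. 379; Purkait 2013, Cor. 5.2) at `N = 128`, `k = 3`, `χ = 1`,
`φ` the newform of level `32`, which entered the tree only as the plain binder `hW` of
`Tunnell1983_waldspurger_triv_of_thm2_of_waldspurgerCor`:

> "Let `φ ∈ S_{k-1}^{new}(M_φ, χ²)` be a newform satisfying (H1). Suppose
> `f = ∑ aₙ qⁿ ∈ S_{k/2}(N, χ, φ)` for some `N ≥ 1` such that `M_φ ∣ N/2`. Suppose `n₁, n₂` are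
> positive square-free integers such that `n₁/n₂ ∈ (ℚ_p^×)²` for all `p ∣ N`. Then
> `a_{n₁}² L(φ χ₀⁻¹ χ_{n₂}, 1) χ(n₂/n₁) n₂^{k/2-1} = a_{n₂}² L(φ χ₀⁻¹ χ_{n₁}, 1) n₁^{k/2-1}`."

Read at `N = 128`, `χ = 1` (module docstring of `TunnellWaldspurgerCorollaryProofs.lean`): the only
prime dividing `N` is `2`, for odd `n₁, n₂` the local condition is `n₁ ≡ n₂ (mod 8)` and
`χ(n₂/n₁) = 1`; `χ₀⁻¹ χ_n = χ₋₄ χ_n` is the character of `ℚ(√(-n))` and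
`L(φ ⊗ χ₋ₙ, 1) = L(E⁽⁻ⁿ⁾, 1) = L(Eₙ, 1)`, the tree's `entireLFunction 1` of `congruentNumberCurve n`
under its guard `HasEntireLFunction` ("`A(t)² = L(φ χ₋₁ χ_t, 1) = L(Eᵗ, 1)`", Tunnell p. 329, l. 8);
`S_{3/2}(128, 1, φ)` is `tunnellSubspace 1`.

This file NAMES that corollary (the explicit exception of 2026-08-16 to D-0027 A7 for
budget-capped facts) and records the assembly:

* `Waldspurger1981_cor2_level128_triv` — **named fact**, verbatim the binder `hW`;
* `Tunnell1983_waldspurger_triv_holds_of` — **the assembly, PROVED**: the corollary implies the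
  leaf (`Tunnell1983_waldspurger_triv_of_thm2_of_waldspurgerCor` fed with
  `Tunnell1983_thm2_triv_holds`).

The child is the single residual of the whole odd half of Tunnell's theorem in the tree
(`Tunnell1983_L_one_odd`, `tunnell_odd`, `tunnell_converse_odd` all follow from it by the sibling
reductions). Its known proofs (Waldspurger via the theta correspondence; Kohnen–Zagier / Kohnen
for level `4M`, `M` odd square-free, which excludes `32`; Baruch–Mao 2007) need the theta
correspondence or the Rankin–Selberg method, absent from Mathlib and the tree.

## References

* J.-L. Waldspurger, *Sur les coefficients de Fourier des formes modulaires de poids demi-entier*,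
  J. Math. Pures Appl. 60 (1981) 375–484, Thm 1 and Corollaire 2 (p. 379). [Waldspurger1981Fourier]
* J. B. Tunnell, Invent. Math. 72 (1983) 323–334: Theorem (Waldspurger) p. 328, proof of Thm 3
  p. 329. [Tunnell1983Congruent]
* S. Purkait, *Explicit application of Waldspurger's theorem*, LMS J. Comput. Math. 16 (2013),
  Cor. 5.2 (the corollary in this form).
-/

noncomputable section

open Complex

namespace Literature.NumberTheory.EllipticCurves

namespace Tunnell1983

open ModularForms

/-- **Waldspurger 1981, Corollaire 2, at `N = 128`, `k = 3`, `χ = 1`, `φ` the newform of level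
`32`** (J. Math. Pures Appl. 60, p. 379; in Tunnell's application, Invent. Math. 72 (1983),
p. 328 (Theorem (Waldspurger)) and p. 329, ll. 7–12). Statement: for every `f` in
`S_{3/2}(128, 1, φ) = tunnellSubspace 1`, all square-free `n₁, n₂` with `n₁` odd and
`n₁ ≡ n₂ (mod 8)` (the local square-class condition at the only prime `2 ∣ N`), under the guards
`HasEntireLFunction` of the tree's `L(E_m, 1)`:
`a_{n₁}(f)² · L(E_{n₂}, 1) · √n₂ = a_{n₂}(f)² · L(E_{n₁}, 1) · √n₁`, where `E_m = congruentNumberCurve m`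
(`L(φ ⊗ χ₋ₘ, 1) = L(E_m, 1)`) and `a_n(f) = qCoeffs f n`. Verbatim the binder `hW` of
`Tunnell1983_waldspurger_triv_of_thm2_of_waldspurgerCor` (`TunnellWaldspurgerCorollaryProofs.lean`).
Named fact (statement only). [cite: Waldspurger1981Fourier, Corollaire 2 (p. 379)]
[cite: Tunnell1983Congruent, Theorem (Waldspurger) p. 328 and p. 329, ll. 7–12] -/
def Waldspurger1981_cor2_level128_triv : Prop :=
  ∀ f ∈ tunnellSubspace 1, ∀ ⦃n₁ n₂ : ℕ⦄, Odd n₁ → Squarefree n₁ →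
    Squarefree n₂ → n₁ % 8 = n₂ % 8 →
    (congruentNumberCurve n₁).HasEntireLFunction → (congruentNumberCurve n₂).HasEntireLFunction →
    qCoeffs f n₁ ^ 2 * (congruentNumberCurve n₂).entireLFunction 1 * (Real.sqrt n₂ : ℂ) =
      qCoeffs f n₂ ^ 2 * (congruentNumberCurve n₁).entireLFunction 1 * (Real.sqrt n₁ : ℂ)

/-- **`Tunnell1983_waldspurger_triv` from its single child.** Waldspurger's Corollaire 2 at level
`128`, trivial character (`Waldspurger1981_cor2_level128_triv`), implies "Waldspurger's theorem as
applied on p. 329" — through `Tunnell1983_waldspurger_triv_of_thm2_of_waldspurgerCor`, whose other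
input, Tunnell's Theorem 2 (`g θ₂, g θ₈ ∈ S_{3/2}(128, 1, φ)`), is the theorem
`Tunnell1983_thm2_triv_holds` of the tree (pairs `(n, 1)`, `(n, 3)`; `a(1) = 1`, `a(3) = 2`;
`L(E₁, 1) = β/4`, `L(E₃, 1) = β/√3`). [cite: Tunnell1983Congruent, proof of Thm 3, p. 329, ll. 7–12] -/
theorem Tunnell1983_waldspurger_triv_holds_of (hW : Waldspurger1981_cor2_level128_triv) :
    Tunnell1983_waldspurger_triv :=
  Tunnell1983_waldspurger_triv_of_thm2_of_waldspurgerCor Tunnell1983_thm2_triv_holds hW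

end Tunnell1983

end Literature.NumberTheory.EllipticCurves

end
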